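import Summits.Parity.GeneralizedHardyLittlewood.Theorems.PrimeLevelFamEdgeMomentsBeyondDiagonalLayersFourierBound
import HarnessLib

/-!
# Route `PrimeLevelFamEdge`, crux K_A `MomentsBeyondDiagonal` (stmt-Parity-20007), line «petersson_layers» v4:
# the Parseval floor WITH MULTIPLICITY — the completion bound for DILATED bilinear Kloosterman forms

`…LayersFourierBound.norm_bilinear_kloostermanSum_le` needs the summation variables to be distinct mod `c`.  The class
forms of `…LayersClassSplit` have DILATED kernels `S(σ₁u, σ₂v; c')`; when a dilated range `σ₁·[1,U]` is longer than the
modulus (the classes with a large AFE sharp part, where Pascadi's `M ≤ c` fails) the points are no longer distinct mod `c'`,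
but each residue is hit at most `m` times.  This file proves the Parseval floor with multiplicity:
* `sum_norm_sq_transform_le_mul`: for any residues `a_u ∈ ℤ/c` (`u ∈ S`) hit with multiplicity `≤ m` on `S`,
  `Σ_{x mod c} ‖Σ_{u∈S} α_u e(a_u x/c)‖² ≤ c·m·Σ‖α_u‖²`;
* **`norm_bilinear_kloostermanSum_dilated_le`**: `‖Σ_{u∈S}Σ_{v∈T} α_u β_v S(a_u, b_v; c)‖ ≤ c √(m₁m₂) ‖α‖₂‖β‖₂` for
  residues `a_u`, `b_v` with multiplicities `≤ m₁`, `≤ m₂`;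
* `card_filter_dilate_congr_le`: the multiplicity of `u ↦ σu mod c` on `[1, U]` is `≤ U/(c/(σ,c)) + 1`.
(For the line: with the class `ℓ²` sizes of `…LayersClassCoeffL2` this floor wins on every class whose dilated mollifier
length exceeds the class modulus — census step E4'', bookkeeping NOT done here.)
Proof only (def-free helper); no layer is bounded here; K_A NOT proved; nothing about Landau–Siegel zeros.
-/

noncomputable section

open Finset
open Literature.NumberTheory.LFunctions

namespace Summit.Parity.GeneralizedHardyLittlewood.Theorems.MomentsBeyondDiagonal.Layers

variable {c : ℕ} [NeZero c]

/-! ## §1. Plancherel with multiplicity -/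

/-- A symmetric double sum over a fibre relation: `Σ_{u∈S} Σ_{u'∈S, a u' = a u} f(u') = Σ_{u'∈S} #{u ∈ S : a u = a u'}·f(u')`.
[folklore] -/
theorem sum_sum_filter_fiber_eq {ι : Type*} [DecidableEq ι] (S : Finset ℕ) (a : ℕ → ι) (f : ℕ → ℝ) :
    ∑ u ∈ S, ∑ u' ∈ S.filter (fun u' ↦ a u' = a u), f u' =
      ∑ u' ∈ S, (#(S.filter (fun u ↦ a u = a u')) : ℝ) * f u' := by
  have h1 : ∀ u ∈ S, ∑ u' ∈ S.filter (fun u' ↦ a u' = a u), f u' =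
      ∑ u' ∈ S, (if a u = a u' then (1 : ℝ) else 0) * f u' := by
    intro u _
    rw [Finset.sum_filter]
    refine sum_congr rfl fun u' _ ↦ ?_
    by_cases h : a u' = a u
    · rw [if_pos h, if_pos h.symm, one_mul]
    · rw [if_neg h, if_neg (fun h' ↦ h h'.symm), zero_mul]
  rw [sum_congr rfl h1, sum_comm]
  refine sum_congr rfl fun u' _ ↦ ?_
  rw [← sum_mul, Finset.sum_boole]

/-- **Plancherel mod `c` with multiplicity.** If every residue `a_u` (`u ∈ S`) is hit at most `m` times on `S`, then
`Σ_{x mod c} ‖Σ_{u∈S} α_u e(a_u x/c)‖² ≤ c · m · Σ_{u∈S} ‖α_u‖²`. [folklore] -/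
theorem sum_norm_sq_transform_le_mul (S : Finset ℕ) (a : ℕ → ZMod c) {m : ℕ}
    (hm : ∀ u ∈ S, #(S.filter (fun u' ↦ a u' = a u)) ≤ m) (α : ℕ → ℂ) :
    ∑ x : ZMod c, ‖∑ u ∈ S, α u * (ZMod.stdAddChar (a u * x) : ℂ)‖ ^ 2 ≤
      (c : ℝ) * m * ∑ u ∈ S, ‖α u‖ ^ 2 := by
  classical
  set A : ZMod c → ℂ := fun x ↦ ∑ u ∈ S, α u * (ZMod.stdAddChar (a u * x) : ℂ) with hA
  have key : ∀ x : ZMod c, ((‖A x‖ : ℝ) : ℂ) ^ 2 =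
      ∑ u ∈ S, ∑ u' ∈ S, α u * (starRingEnd ℂ) (α u') * (ZMod.stdAddChar (x * (a u - a u')) : ℂ) := by
    intro x
    rw [← Complex.ofReal_pow, ← Complex.normSq_eq_norm_sq, ← Complex.mul_conj, hA]
    dsimp only
    rw [map_sum, Finset.sum_mul_sum]
    refine Finset.sum_congr rfl fun u _ ↦ Finset.sum_congr rfl fun u' _ ↦ ?_
    rw [map_mul (starRingEnd ℂ) (α u'), ← AddChar.map_neg_eq_conj]
    have hψ : (ZMod.stdAddChar (a u * x) : ℂ) * ZMod.stdAddChar (-(a u' * x)) =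
        ZMod.stdAddChar (x * (a u - a u')) := by
      rw [← AddChar.map_add_eq_mul]
      congr 1
      ring
    rw [← hψ]
    ring
  have horth : ∀ b : ZMod c, ∑ x : ZMod c, (ZMod.stdAddChar (x * b) : ℂ) = if b = 0 then (c : ℂ) else 0 := by
    intro b
    rw [AddChar.sum_mulShift b (ZMod.isPrimitive_stdAddChar c), ZMod.card]
    split_ifs <;> simp
  -- the complex identity: `Σ_x ‖A x‖² = c · Σ_u Σ_{u' : a u' = a u} α_u conj(α_u')`
  have hsum : ∑ x : ZMod c, ((‖A x‖ : ℝ) : ℂ) ^ 2 =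
      (c : ℂ) * ∑ u ∈ S, ∑ u' ∈ S.filter (fun u' ↦ a u' = a u), α u * (starRingEnd ℂ) (α u') := by
    simp_rw [key]
    rw [Finset.sum_comm, Finset.mul_sum]
    refine Finset.sum_congr rfl fun u _ ↦ ?_
    rw [Finset.sum_comm, Finset.mul_sum, Finset.sum_filter]
    refine Finset.sum_congr rfl fun u' _ ↦ ?_
    rw [← Finset.mul_sum, horth]
    by_cases h : a u' = a u
    · rw [if_pos (sub_eq_zero.mpr h.symm), if_pos h]; ring
    · rw [if_neg (fun h0 ↦ h (sub_eq_zero.mp h0).symm), if_neg h]; ring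
  -- take norms
  have hreal : ∑ x : ZMod c, ‖A x‖ ^ 2 =
      ‖(c : ℂ) * ∑ u ∈ S, ∑ u' ∈ S.filter (fun u' ↦ a u' = a u), α u * (starRingEnd ℂ) (α u')‖ := by
    rw [← hsum]
    have : (∑ x : ZMod c, ((‖A x‖ : ℝ) : ℂ) ^ 2) = ((∑ x : ZMod c, ‖A x‖ ^ 2 : ℝ) : ℂ) := by push_cast; rfl
    rw [this, Complex.norm_real, Real.norm_eq_abs, abs_of_nonneg (sum_nonneg fun _ _ ↦ sq_nonneg _)]
  rw [hreal, norm_mul, Complex.norm_natCast]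
  rw [mul_assoc]
  refine mul_le_mul_of_nonneg_left ?_ (Nat.cast_nonneg c)
  -- `‖Σ_u Σ_{u'∼u} α_u conj α_{u'}‖ ≤ Σ_u Σ_{u'∼u} (‖α_u‖² + ‖α_{u'}‖²)/2 ≤ m ‖α‖²`
  calc ‖∑ u ∈ S, ∑ u' ∈ S.filter (fun u' ↦ a u' = a u), α u * (starRingEnd ℂ) (α u')‖
      ≤ ∑ u ∈ S, ∑ u' ∈ S.filter (fun u' ↦ a u' = a u), (‖α u‖ ^ 2 + ‖α u'‖ ^ 2) / 2 := by
        refine (norm_sum_le _ _).trans (sum_le_sum fun u _ ↦ (norm_sum_le _ _).trans (sum_le_sum fun u' _ ↦ ?_))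
        rw [norm_mul, Complex.norm_conj]
        nlinarith [sq_nonneg (‖α u‖ - ‖α u'‖)]
    _ = ∑ u ∈ S, ∑ u' ∈ S.filter (fun u' ↦ a u' = a u), ‖α u‖ ^ 2 / 2 +
          ∑ u ∈ S, ∑ u' ∈ S.filter (fun u' ↦ a u' = a u), ‖α u'‖ ^ 2 / 2 := by
        rw [← sum_add_distrib]
        refine sum_congr rfl fun u _ ↦ ?_
        rw [← sum_add_distrib]
        refine sum_congr rfl fun u' _ ↦ ?_
        ring
    _ ≤ (m : ℝ) * (∑ u ∈ S, ‖α u‖ ^ 2 / 2) + (m : ℝ) * (∑ u' ∈ S, ‖α u'‖ ^ 2 / 2) := by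
        refine add_le_add ?_ ?_
        · rw [mul_sum]
          refine sum_le_sum fun u hu ↦ ?_
          rw [sum_const, nsmul_eq_mul]
          exact mul_le_mul_of_nonneg_right (by exact_mod_cast hm u hu) (by positivity)
        · rw [sum_sum_filter_fiber_eq S a (fun u' ↦ ‖α u'‖ ^ 2 / 2), mul_sum]
          refine sum_le_sum fun u' hu' ↦ mul_le_mul_of_nonneg_right ?_ (by positivity)
          exact_mod_cast hm u' hu'
    _ = (m : ℝ) * ∑ u ∈ S, ‖α u‖ ^ 2 := by
        rw [← mul_add, ← sum_add_distrib]
        congr 1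
        refine sum_congr rfl fun u _ ↦ ?_
        ring

/-! ## §2. The completion bound for dilated (general-residue) bilinear Kloosterman forms -/

/-- Opening the Kloosterman sums (general residues): `Σ_{u,v} α_u β_v S(a_u, b_v; c) = Σ_{w ∈ (ℤ/c)ˣ} A(w) B(w̄)`,
`A(x) = Σ_u α_u e(a_u x/c)`, `B(x) = Σ_v β_v e(b_v x/c)`. [folklore] -/
theorem bilinear_kloostermanSum_eq_sum_units' (S T : Finset ℕ) (a b : ℕ → ZMod c) (α β : ℕ → ℂ) :
    ∑ u ∈ S, ∑ v ∈ T, α u * β v * kloostermanSum c (a u) (b v) =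
      ∑ w : (ZMod c)ˣ, (∑ u ∈ S, α u * (ZMod.stdAddChar (a u * (w : ZMod c)) : ℂ)) *
        (∑ v ∈ T, β v * (ZMod.stdAddChar (b v * ((w⁻¹ : (ZMod c)ˣ) : ZMod c)) : ℂ)) := by
  calc ∑ u ∈ S, ∑ v ∈ T, α u * β v * kloostermanSum c (a u) (b v)
      = ∑ u ∈ S, ∑ v ∈ T, ∑ w : (ZMod c)ˣ, α u * β v *
          ((ZMod.stdAddChar (a u * (w : ZMod c)) : ℂ) *
            (ZMod.stdAddChar (b v * ((w⁻¹ : (ZMod c)ˣ) : ZMod c)) : ℂ)) := by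
        refine Finset.sum_congr rfl fun u _ ↦ Finset.sum_congr rfl fun v _ ↦ ?_
        rw [kloostermanSum_eq_sum_units, Finset.mul_sum]
        refine Finset.sum_congr rfl fun w _ ↦ ?_
        rw [AddChar.map_add_eq_mul]
    _ = ∑ w : (ZMod c)ˣ, ∑ u ∈ S, ∑ v ∈ T, α u * β v *
          ((ZMod.stdAddChar (a u * (w : ZMod c)) : ℂ) *
            (ZMod.stdAddChar (b v * ((w⁻¹ : (ZMod c)ˣ) : ZMod c)) : ℂ)) := by
        rw [Finset.sum_congr rfl fun u _ ↦ Finset.sum_comm]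
        exact Finset.sum_comm
    _ = _ := by
        refine Finset.sum_congr rfl fun w _ ↦ ?_
        rw [Finset.sum_mul_sum]
        refine Finset.sum_congr rfl fun u _ ↦ Finset.sum_congr rfl fun v _ ↦ ?_
        ring

/-- **THE COMPLETION BOUND WITH MULTIPLICITY** (any modulus `c ≥ 1`, any residues): if `u ↦ a_u` has multiplicity `≤ m₁`
on `S` and `v ↦ b_v` multiplicity `≤ m₂` on `T`, then
`‖Σ_{u∈S} Σ_{v∈T} α_u β_v S(a_u, b_v; c)‖ ≤ c · √m₁ · √m₂ · ‖α‖₂ · ‖β‖₂`.  With `a_u = σ₁u`, `b_v = σ₂v` this is the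
Parseval floor for DILATED bilinear Kloosterman forms. [cite: KerrShparlinskiWuXi2023, §1.1 (the trivial Fourier bound)] -/
theorem norm_bilinear_kloostermanSum_dilated_le (S T : Finset ℕ) (a b : ℕ → ZMod c) {m₁ m₂ : ℕ}
    (hm₁ : ∀ u ∈ S, #(S.filter (fun u' ↦ a u' = a u)) ≤ m₁)
    (hm₂ : ∀ v ∈ T, #(T.filter (fun v' ↦ b v' = b v)) ≤ m₂) (α β : ℕ → ℂ) :
    ‖∑ u ∈ S, ∑ v ∈ T, α u * β v * kloostermanSum c (a u) (b v)‖ ≤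
      (c : ℝ) * Real.sqrt m₁ * Real.sqrt m₂ *
        Real.sqrt (∑ u ∈ S, ‖α u‖ ^ 2) * Real.sqrt (∑ v ∈ T, ‖β v‖ ^ 2) := by
  set A : ZMod c → ℂ := fun x ↦ ∑ u ∈ S, α u * (ZMod.stdAddChar (a u * x) : ℂ) with hA
  set B : ZMod c → ℂ := fun x ↦ ∑ v ∈ T, β v * (ZMod.stdAddChar (b v * x) : ℂ) with hB
  have hopen : ∑ u ∈ S, ∑ v ∈ T, α u * β v * kloostermanSum c (a u) (b v) =
      ∑ w : (ZMod c)ˣ, A (w : ZMod c) * B ((w⁻¹ : (ZMod c)ˣ) : ZMod c) :=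
    bilinear_kloostermanSum_eq_sum_units' S T a b α β
  rw [hopen]
  have h1 : ‖∑ w : (ZMod c)ˣ, A (w : ZMod c) * B ((w⁻¹ : (ZMod c)ˣ) : ZMod c)‖ ≤
      ∑ w : (ZMod c)ˣ, ‖A (w : ZMod c)‖ * ‖B ((w⁻¹ : (ZMod c)ˣ) : ZMod c)‖ :=
    (norm_sum_le _ _).trans (le_of_eq (Finset.sum_congr rfl fun w _ ↦ norm_mul _ _))
  have hCS : ∀ f g : (ZMod c)ˣ → ℝ,
      ∑ i, f i * g i ≤ Real.sqrt (∑ i, f i ^ 2) * Real.sqrt (∑ i, g i ^ 2) := by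
    intro f g
    have h := Finset.sum_mul_sq_le_sq_mul_sq (Finset.univ : Finset (ZMod c)ˣ) f g
    have h1 : ∑ i, f i * g i ≤ |∑ i, f i * g i| := le_abs_self _
    rw [← Real.sqrt_sq_eq_abs] at h1
    refine h1.trans ?_
    rw [← Real.sqrt_mul (Finset.sum_nonneg fun i _ ↦ sq_nonneg (f i))]
    exact Real.sqrt_le_sqrt h
  have h2 := hCS (fun w : (ZMod c)ˣ ↦ ‖A (w : ZMod c)‖) (fun w : (ZMod c)ˣ ↦ ‖B ((w⁻¹ : (ZMod c)ˣ) : ZMod c)‖)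
  have hAle : ∑ w : (ZMod c)ˣ, ‖A (w : ZMod c)‖ ^ 2 ≤ (c : ℝ) * m₁ * ∑ u ∈ S, ‖α u‖ ^ 2 :=
    (sum_units_le_sum (g := fun x ↦ ‖A x‖ ^ 2) fun x ↦ sq_nonneg _).trans
      (sum_norm_sq_transform_le_mul S a hm₁ α)
  have hBle : ∑ w : (ZMod c)ˣ, ‖B ((w⁻¹ : (ZMod c)ˣ) : ZMod c)‖ ^ 2 ≤ (c : ℝ) * m₂ * ∑ v ∈ T, ‖β v‖ ^ 2 := by
    rw [sum_units_inv_eq (fun x ↦ ‖B x‖ ^ 2)]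
    exact (sum_units_le_sum (g := fun x ↦ ‖B x‖ ^ 2) fun x ↦ sq_nonneg _).trans
      (sum_norm_sq_transform_le_mul T b hm₂ β)
  have hc0 : (0 : ℝ) ≤ c := Nat.cast_nonneg c
  have hcm₁ : (0 : ℝ) ≤ (c : ℝ) * m₁ := by positivity
  have hcm₂ : (0 : ℝ) ≤ (c : ℝ) * m₂ := by positivity
  calc ‖∑ w : (ZMod c)ˣ, A (w : ZMod c) * B ((w⁻¹ : (ZMod c)ˣ) : ZMod c)‖
      ≤ ∑ w : (ZMod c)ˣ, ‖A (w : ZMod c)‖ * ‖B ((w⁻¹ : (ZMod c)ˣ) : ZMod c)‖ := h1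
    _ ≤ Real.sqrt (∑ w : (ZMod c)ˣ, ‖A (w : ZMod c)‖ ^ 2) *
          Real.sqrt (∑ w : (ZMod c)ˣ, ‖B ((w⁻¹ : (ZMod c)ˣ) : ZMod c)‖ ^ 2) := h2
    _ ≤ Real.sqrt ((c : ℝ) * m₁ * ∑ u ∈ S, ‖α u‖ ^ 2) * Real.sqrt ((c : ℝ) * m₂ * ∑ v ∈ T, ‖β v‖ ^ 2) :=
        mul_le_mul (Real.sqrt_le_sqrt hAle) (Real.sqrt_le_sqrt hBle) (Real.sqrt_nonneg _) (Real.sqrt_nonneg _)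
    _ = (c : ℝ) * Real.sqrt m₁ * Real.sqrt m₂ *
          Real.sqrt (∑ u ∈ S, ‖α u‖ ^ 2) * Real.sqrt (∑ v ∈ T, ‖β v‖ ^ 2) := by
        rw [Real.sqrt_mul hcm₁, Real.sqrt_mul hcm₂, Real.sqrt_mul hc0, Real.sqrt_mul hc0]
        have hcc : Real.sqrt (c : ℝ) * Real.sqrt (c : ℝ) = c := Real.mul_self_sqrt hc0
        calc Real.sqrt ↑c * Real.sqrt ↑m₁ * Real.sqrt (∑ u ∈ S, ‖α u‖ ^ 2) *
              (Real.sqrt ↑c * Real.sqrt ↑m₂ * Real.sqrt (∑ v ∈ T, ‖β v‖ ^ 2))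
            = (Real.sqrt ↑c * Real.sqrt ↑c) * Real.sqrt ↑m₁ * Real.sqrt ↑m₂ *
                Real.sqrt (∑ u ∈ S, ‖α u‖ ^ 2) * Real.sqrt (∑ v ∈ T, ‖β v‖ ^ 2) := by ring
          _ = _ := by rw [hcc]

/-! ## §3. The multiplicity of a dilation -/

/-- If `σu' ≡ σu (mod c)` then `c/(σ,c)` divides the difference: for `u ≤ u'`, `c/(σ,c) ∣ u' − u`. [folklore] -/
theorem div_gcd_dvd_sub_of_dilate_congr {σ u u' : ℕ} (huu' : u ≤ u')
    (h : ((σ * u' : ℕ) : ZMod c) = ((σ * u : ℕ) : ZMod c)) : c / Nat.gcd σ c ∣ u' - u := by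
  have hc : c ≠ 0 := NeZero.ne c
  have hdvd : c ∣ σ * u' - σ * u := by
    have h' := (ZMod.natCast_eq_natCast_iff' _ _ _).mp h
    exact (Nat.modEq_iff_dvd' (Nat.mul_le_mul_left σ huu')).mp h'.symm
  rw [← Nat.mul_sub] at hdvd
  set γ := Nat.gcd σ c with hγ
  have hγ0 : 0 < γ := Nat.pos_of_ne_zero (by rw [hγ]; exact Nat.gcd_ne_zero_right hc)
  have hγσ : γ ∣ σ := Nat.gcd_dvd_left σ c
  have hγc : γ ∣ c := Nat.gcd_dvd_right σ c
  have hcop : Nat.Coprime (c / γ) (σ / γ) := by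
    rw [Nat.coprime_comm]
    exact Nat.coprime_div_gcd_div_gcd hγ0
  have h2 : c / γ ∣ σ / γ * (u' - u) := by
    have : σ * (u' - u) = γ * (σ / γ * (u' - u)) := by
      rw [← mul_assoc, Nat.mul_div_cancel' hγσ]
    rw [this] at hdvd
    have hc' : c = γ * (c / γ) := (Nat.mul_div_cancel' hγc).symm
    rw [hc'] at hdvd
    exact Nat.dvd_of_mul_dvd_mul_left hγ0 hdvd
  exact hcop.dvd_of_dvd_mul_left h2

/-- **The multiplicity of `u ↦ σu mod c` on `[1, U]`** is at most `U/(c/(σ,c)) + 1`: the fibre of `u` lies in the residue class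
of `u` modulo `c/(σ,c)`. [folklore] -/
theorem card_filter_dilate_congr_le (σ U u : ℕ) :
    #((Icc 1 U).filter (fun u' ↦ ((σ * u' : ℕ) : ZMod c) = ((σ * u : ℕ) : ZMod c))) ≤ U / (c / Nat.gcd σ c) + 1 := by
  set L := c / Nat.gcd σ c with hL
  have hc : c ≠ 0 := NeZero.ne c
  have hL0 : 0 < L := by
    rw [hL]
    exact Nat.div_pos (Nat.le_of_dvd (Nat.pos_of_ne_zero hc) (Nat.gcd_dvd_right σ c))
      (Nat.pos_of_ne_zero (Nat.gcd_ne_zero_right hc))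
  -- the fibre is contained in `{u' ∈ [1, U] : u' ≡ u mod L}`, which injects into `[0, U/L]` by `u' ↦ u'/L`
  have hsub : (Icc 1 U).filter (fun u' ↦ ((σ * u' : ℕ) : ZMod c) = ((σ * u : ℕ) : ZMod c)) ⊆
      (Icc 1 U).filter (fun u' ↦ u' % L = u % L) := by
    intro u' hu'
    simp only [mem_filter] at hu' ⊢
    refine ⟨hu'.1, ?_⟩
    rcases le_total u u' with hle | hle
    · have hd := div_gcd_dvd_sub_of_dilate_congr (c := c) hle hu'.2
      exact ((Nat.modEq_iff_dvd' hle).mpr hd).symm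
    · have hd := div_gcd_dvd_sub_of_dilate_congr (c := c) hle hu'.2.symm
      exact (Nat.modEq_iff_dvd' hle).mpr hd
  refine (card_le_card hsub).trans ?_
  -- inject `u' ↦ u' / L` into `range (U / L + 1)`
  have hinj : Set.InjOn (fun u' : ℕ ↦ u' / L) ((Icc 1 U).filter (fun u' ↦ u' % L = u % L) : Finset ℕ) := by
    intro x hx y hy hxy
    simp only [coe_filter, Set.mem_setOf_eq] at hx hy
    have ex := Nat.div_add_mod x L
    have ey := Nat.div_add_mod y L
    have : x / L = y / L := hxy
    rw [← ex, ← ey, this, hx.2, hy.2]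
  have himg : ((Icc 1 U).filter (fun u' ↦ u' % L = u % L)).image (fun u' : ℕ ↦ u' / L) ⊆ range (U / L + 1) := by
    intro k hk
    simp only [mem_image, mem_filter, mem_Icc] at hk
    obtain ⟨u', ⟨⟨-, hu'U⟩, -⟩, rfl⟩ := hk
    exact mem_range.mpr (Nat.lt_succ_of_le (Nat.div_le_div_right hu'U))
  calc #((Icc 1 U).filter (fun u' ↦ u' % L = u % L))
      = #(((Icc 1 U).filter (fun u' ↦ u' % L = u % L)).image (fun u' : ℕ ↦ u' / L)) :=
        (card_image_of_injOn hinj).symm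
    _ ≤ #(range (U / L + 1)) := card_le_card himg
    _ = U / L + 1 := card_range _

end Summit.Parity.GeneralizedHardyLittlewood.Theorems.MomentsBeyondDiagonal.Layers

end
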